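import Summits.ValiantsHypothesis.ValiantsHypothesis.Theorems.KPlusLogSqLawTropicalBTopHeavyCoreTransversal
import Summits.ValiantsHypothesis.ValiantsHypothesis.Theorems.KPlusLogSqLawTropicalBTopHeavyCoreArcChoice

/-!
# Route «KPlusLogSqLaw», crux `TropicalB` (stmt-ValiantsHypothesis-19771) — THE MULTI-RAISE TRANSFER LAW (all `m`):
# one big raise, small other raises, deficits under one raised surplus ⇒ `P_A`, `P_B`, `P_C` are never all dominant

HONEST FRAMING.  Helper file (cell `pub-symmetroid`, seat val-sym-trop-p1 g23, 2026-08-29; `--supports stmt-ValiantsHypothesis-19771 --as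
helper`) of the κ-programme («is `(m,5)` ever counting-tight?») of this lineage: the FIRST TWO-RAISED all-`m` transfer law announced in
memo HOME/val-sym-trop-p1/g21/CORE-LAW-C-g21.md §9, proved here in a GENERAL form from the landed toolkit (`core_of_transversal`,
`oneJump_injective` …TopHeavyCoreTransversal; `exists_arcFamily` / `exists_arc` / `cover_eq` …TopHeavyCoreArc; `exists_arc_mem`,
`moved_of_raised` / `moved_of_lowered` …TopHeavyCoreArcChoice).  A census-STRUCTURE law (a 3-body obstruction on dominant terms of an
arbitrary dominance design); nothing here bounds `TropicalB` in its window and nothing bears on `WeakLifting`, DoorA26 / DoorA34,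
`MatrixDescartes` (stmt-ValiantsHypothesis-18050) or VP ≠ VNP.

THE LAW (`multiRaise_transfer`).  Dominant `P_A = (σA, λA)`, `P_B = (σB, λB)`, `P_C = (σC, λC)` with `P_C` latest (`θA, θB < θC`), `λC ≡ c₀`
off one column `c`, `d c₀ ≤ d (λC ·)`, `d c₀ < d (λA ·), d (λB ·)`.  Column `x` is RAISED if `d (λA x) < d (λB x)` (raise `d (λB x) − d (λA x)`),
LOWERED if `d (λB x) < d (λA x)` (deficit); `A`-surplus of `y` = `d (λA y) − d c₀`, `B`-surplus = `d (λB y) − d c₀`.  IF (L) some column is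
lowered; (S) a designated column `s` is raised (arbitrarily much); (A1) for every `y`, the raises at raised columns other than `s`, `y` SUM to at
most the `A`-surplus of `y`; (B1) some raised `b` has `B`-surplus ≥ every deficit — THEN the three terms are not all dominant.  PROOF (two arc
families, one jump each, `core_of_transversal`).  `P_B` earlier: raised columns are moved by `τ = σA⁻¹σB` (`moved_of_raised`), so the UNPRIMED
family (`P = σC⁻¹σB`; selector «`σC` off `U`, `σB` on `U ∖ {j}`, `σA` at `j`») has an arc `U ∋ c` avoiding `b` or ending at `b` (`exists_arc`);
its condition «deficit at `j` ≤ `B`-surplus off `U`» is (B1) or trivial (`j = b` raised).  `P_A` earlier: lowered columns are moved.  If `τ s ≠ s`: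
an unprimed arc `U ∋ c` avoiding `s` or ending at `s`; condition «raises on `U ∖ {j}` ≤ `A`-surplus off `U`» is (A1) at any `y ∉ U`.  If
`τ s = s`: the PRIMED family (`P′ = σC⁻¹σA`, `τ′ = σB⁻¹σA`; selector «`σC` off `U′`, `σA` on `U′ ∖ {j}`, `σB` at `j`» = the law with `A ↔ B`)
has an arc through `c` (`exists_arc_mem`) whose end `j` is moved, hence `≠ s`; condition «raise at `j` ≤ `A`-surplus off `U′`» is (A1).

INSTANCES.  `two_raised_transfer` — the family of the memo (§9 TARGET): `d c₀ < d c₁ < d c₂ < d c₃`; `λA = c₁` at `p`, `c₂` elsewhere;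
`λB = c₂` at `p`, `c₃` at `s`, `c₁` on a nonempty set `Q` of columns (`p, s ∉ Q`), `c₂` elsewhere; `λC ≡ c₀` off `c`: histograms
`c₁c₂^{m−1}`, `c₁^{|Q|} c₂^{m−1−|Q|} c₃`, `c₀^{m−1}·` — for `|Q| = 2` the (2,2)→(1,3) transfer pair `A`, `A − 2c₂ + c₁ + c₃` in the
arrangement NOT covered by `transfer_aligned` (located infeasible for `m ≤ 5`, memo §6–§7; here proved for every `m` and every `|Q| ≥ 1`).
`core_law_C_of_multiRaise` — CORE LAW C (`core_law_C`, …TopHeavyCoreArc) is the instance «no small raise, `b = s`» (re-derived as a check of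
the general statement).
[this cell; combinatorics folklore]
-/

set_option linter.dupNamespace false
set_option autoImplicit false

namespace Summit.ValiantsHypothesis.ValiantsHypothesis.Theorems.KPlusLogSqLaw.TopHeavyCore

open Summit.ValiantsHypothesis.ValiantsHypothesis.Theorems.MatrixDescartes.Negative
open scoped BigOperators
open Finset

variable {m K : ℕ}

/-! ## 1. Packaging: the cycle `σC⁻¹σX`, and the one-jump form of the transversal law -/

/-- from `hamiltonian_AC`: for `P_X` earlier than the `c₀`-heavy latest term `P_C`, the permutation `σC⁻¹σX` is fixed-point free with a
single cycle class (the form the arc toolkit consumes). [this cell] -/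
theorem cycle_CX (d : Fin K → ℕ) (v ε : Fin m → Fin m → Fin K → ℤ) {θX θC : ℤ} (hXC : θX < θC)
    {σX σC : Equiv.Perm (Fin m)} {lX lC : Fin m → Fin K} (hX : IsDominant d v ε θX (σX, lX)) (hC : IsDominant d v ε θC (σC, lC))
    (c : Fin m) {c₀ : Fin K} (hlC : ∀ b, b ≠ c → lC b = c₀) (hlow : ∀ b, d c₀ < d (lX b)) (hm : 2 ≤ m) :
    (∀ x, (σC⁻¹ * σX) x ≠ x) ∧ ∀ x y, (σC⁻¹ * σX).SameCycle x y := by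
  obtain ⟨hfixXC, hcycXC⟩ := hamiltonian_AC d v ε hXC hX hC c hlC hlow hm
  have hPinv : σC⁻¹ * σX = (σX⁻¹ * σC)⁻¹ := by rw [mul_inv_rev, inv_inv]
  refine ⟨fun x h => hfixXC x ?_, fun x y => ?_⟩
  · rw [Equiv.Perm.mul_apply, Equiv.Perm.inv_eq_iff_eq]
    rw [Equiv.Perm.mul_apply, Equiv.Perm.inv_eq_iff_eq] at h
    exact h.symm
  · rw [hPinv, Equiv.Perm.sameCycle_inv]
    exact (hcycXC x).symm.trans (hcycXC y)

/-- **one-jump form of the transversal law** (`core_of_transversal` with `J = {j}`, selector written with `x = j`). [this cell] -/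
theorem core_of_oneJump (d : Fin K → ℕ) (v ε : Fin m → Fin m → Fin K → ℤ) (hm : 2 ≤ m)
    {c₀ : Fin K} {σA σB σC : Equiv.Perm (Fin m)} {lA lB lC : Fin m → Fin K} {c : Fin m}
    (hlC : ∀ x, x ≠ c → lC x = c₀) (hCge : ∀ x, d c₀ ≤ d (lC x)) (hlowA : ∀ x, d c₀ < d (lA x)) (hlowB : ∀ x, d c₀ < d (lB x))
    {θA θB θC : ℤ} (hA : IsDominant d v ε θA (σA, lA)) (hB : IsDominant d v ε θB (σB, lB)) (hC : IsDominant d v ε θC (σC, lC))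
    (hAC : θA < θC) (hBC : θB < θC) (hAB : θA ≠ θB)
    (U : Finset (Fin m)) (j : Fin m) (hjU : j ∈ U) (hcU : c ∈ U) (hUne : U ≠ univ)
    (hinj : Function.Injective fun x => if x ∈ U then (if x = j then σA x else σB x) else σC x)
    (hsumA : θA < θB → ∑ x ∈ U.erase j, (d (lB x) : ℤ) + ∑ _x ∈ Uᶜ, (d c₀ : ℤ) ≤
      ∑ x ∈ U.erase j, (d (lA x) : ℤ) + ∑ x ∈ Uᶜ, (d (lA x) : ℤ))
    (hsumB : θB < θA → (d (lA j) : ℤ) + ∑ _x ∈ Uᶜ, (d c₀ : ℤ) ≤ (d (lB j) : ℤ) + ∑ x ∈ Uᶜ, (d (lB x) : ℤ)) : False := by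
  classical
  have e : ∀ x, (if x ∈ U then (if x ∈ ({j} : Finset (Fin m)) then σA x else σB x) else σC x) =
      (if x ∈ U then (if x = j then σA x else σB x) else σC x) := fun x => by
    by_cases hx : x ∈ U <;> by_cases hxj : x = j <;> simp [hx, hxj]
  refine core_of_transversal d v ε hm hlC hCge hlowA hlowB hA hB hC hAC hBC hAB U {j} (singleton_subset_iff.mpr hjU) hcU hUne
    ?_ ?_ ?_
  · intro x y hxy
    apply hinj
    change (if x ∈ U then (if x ∈ ({j} : Finset (Fin m)) then σA x else σB x) else σC x) =
      (if y ∈ U then (if y ∈ ({j} : Finset (Fin m)) then σA y else σB y) else σC y) at hxy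
    change (if x ∈ U then (if x = j then σA x else σB x) else σC x) =
      (if y ∈ U then (if y = j then σA y else σB y) else σC y)
    rw [← e x, ← e y]; exact hxy
  · intro h
    rw [sdiff_singleton_eq_erase]
    exact hsumA h
  · intro h
    rw [sum_singleton, sum_singleton]
    exact hsumB h

/-! ## 2. The multi-raise transfer law -/

/-- **MULTI-RAISE TRANSFER LAW** (all `m`).  See the module docstring: `P_C` latest and `c₀`-heavy off one column; (L) a lowered column;
(S) `s` raised; (A1) `∀ y, Σ_{x ≠ s, x ≠ y, x raised} (d (λB x) − d (λA x)) ≤ d (λA y) − d c₀`; (B1) `∃ b` raised with every deficit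
`d (λA j) − d (λB j) ≤ d (λB b) − d c₀` ⇒ the three terms are not all dominant. [this cell] -/
theorem multiRaise_transfer (d : Fin K → ℕ) (v ε : Fin m → Fin m → Fin K → ℤ)
    {c₀ : Fin K} {σA σB σC : Equiv.Perm (Fin m)} {lA lB lC : Fin m → Fin K} {c s : Fin m}
    (hlC : ∀ x, x ≠ c → lC x = c₀) (hCge : ∀ x, d c₀ ≤ d (lC x)) (hlowA : ∀ x, d c₀ < d (lA x)) (hlowB : ∀ x, d c₀ < d (lB x))
    {θA θB θC : ℤ} (hA : IsDominant d v ε θA (σA, lA)) (hB : IsDominant d v ε θB (σB, lB)) (hC : IsDominant d v ε θC (σC, lC))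
    (hAC : θA < θC) (hBC : θB < θC)
    (hL : ∃ q, d (lB q) < d (lA q)) (hs : d (lA s) < d (lB s))
    (hA1 : ∀ y, ∑ x ∈ univ.filter (fun x => x ≠ s ∧ x ≠ y ∧ d (lA x) < d (lB x)), ((d (lB x) : ℤ) - d (lA x)) ≤
      (d (lA y) : ℤ) - d c₀)
    (hB1 : ∃ b, d (lA b) < d (lB b) ∧ ∀ j, (d (lA j) : ℤ) - d (lB j) ≤ (d (lB b) : ℤ) - d c₀) : False := by
  classical
  obtain ⟨q, hq⟩ := hL
  -- `P_A ≠ P_B`, `θA ≠ θB`, `m ≥ 2`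
  have hABne : ((σA, lA) : Equiv.Perm (Fin m) × (Fin m → Fin K)) ≠ (σB, lB) := by
    intro h
    have : lA q = lB q := by rw [(Prod.mk.inj h).2]
    rw [this] at hq; exact lt_irrefl _ hq
  have hAB : θA ≠ θB := by
    rintro rfl
    exact lt_asymm (hA.2 _ (Ne.symm hABne) hB.1) (hB.2 _ hABne hA.1)
  have hqs : q ≠ s := by rintro rfl; exact lt_asymm hq hs
  have hm : 2 ≤ m := by
    have h := card_le_card (subset_univ ({q, s} : Finset (Fin m)))
    rw [card_pair hqs, card_univ, Fintype.card_fin] at h; exact h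
  -- arithmetic: a single surplus is below the total surplus off an arc
  have hsurA : ∀ (U : Finset (Fin m)) (x₀ : Fin m), x₀ ∉ U →
      (d (lA x₀) : ℤ) - d c₀ ≤ ∑ x ∈ Uᶜ, (d (lA x) : ℤ) - ∑ _x ∈ Uᶜ, (d c₀ : ℤ) := by
    intro U x₀ hx₀
    rw [← Finset.sum_sub_distrib]
    refine Finset.single_le_sum (f := fun x => (d (lA x) : ℤ) - d c₀) (fun x _ => ?_) (mem_compl.mpr hx₀)
    have h := (hlowA x).le
    have : (d c₀ : ℤ) ≤ d (lA x) := by exact_mod_cast h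
    linarith
  have hsurB : ∀ (U : Finset (Fin m)) (x₀ : Fin m), x₀ ∉ U →
      (d (lB x₀) : ℤ) - d c₀ ≤ ∑ x ∈ Uᶜ, (d (lB x) : ℤ) - ∑ _x ∈ Uᶜ, (d c₀ : ℤ) := by
    intro U x₀ hx₀
    rw [← Finset.sum_sub_distrib]
    refine Finset.single_le_sum (f := fun x => (d (lB x) : ℤ) - d c₀) (fun x _ => ?_) (mem_compl.mpr hx₀)
    have h := (hlowB x).le
    have : (d c₀ : ℤ) ≤ d (lB x) := by exact_mod_cast h
    linarith
  -- arithmetic: the raises on a column set avoiding `s` and `y` total at most the `A`-surplus of `y` (hypothesis (A1))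
  have hraise : ∀ (S : Finset (Fin m)) (y : Fin m), s ∉ S → y ∉ S →
      ∑ x ∈ S, ((d (lB x) : ℤ) - d (lA x)) ≤ (d (lA y) : ℤ) - d c₀ := by
    intro S y hsS hyS
    calc ∑ x ∈ S, ((d (lB x) : ℤ) - d (lA x))
        ≤ ∑ x ∈ S.filter (fun x => d (lA x) < d (lB x)), ((d (lB x) : ℤ) - d (lA x)) := by
          rw [← Finset.sum_filter_add_sum_filter_not S (fun x => d (lA x) < d (lB x))]
          have hle : ∑ x ∈ S.filter (fun x => ¬ d (lA x) < d (lB x)), ((d (lB x) : ℤ) - d (lA x)) ≤ 0 :=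
            Finset.sum_nonpos fun x hx => by
              have h := not_lt.mp (mem_filter.mp hx).2
              have : (d (lB x) : ℤ) ≤ d (lA x) := by exact_mod_cast h
              linarith
          linarith
      _ ≤ ∑ x ∈ univ.filter (fun x => x ≠ s ∧ x ≠ y ∧ d (lA x) < d (lB x)), ((d (lB x) : ℤ) - d (lA x)) := by
          apply Finset.sum_le_sum_of_subset_of_nonneg
          · intro x hx
            obtain ⟨hxS, hxr⟩ := mem_filter.mp hx
            exact mem_filter.mpr ⟨mem_univ _, fun h => hsS (h ▸ hxS), fun h => hyS (h ▸ hxS), hxr⟩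
          · intro x hx _
            have h := (mem_filter.mp hx).2.2.2
            have : (d (lA x) : ℤ) < d (lB x) := by exact_mod_cast h
            linarith
      _ ≤ (d (lA y) : ℤ) - d c₀ := hA1 y
  rcases lt_or_gt_of_ne hAB with hlt | hgt
  · -- CASE `P_A` earlier (`θA < θB`): the lowered column `q` is moved by `τ = σA⁻¹σB`
    have hqτ : (σA⁻¹ * σB) q ≠ q := moved_of_lowered d v ε hA hB hlt hq
    by_cases hsτ : (σA⁻¹ * σB) s = s
    · -- PRIMED family: `P = σC⁻¹σA`, `τ = σB⁻¹σA`, selector «`σC` off `U`, `σA` on `U ∖ {j}`, `σB` at `j`» (roles of `A`, `B` exchanged)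
      obtain ⟨hfix, hcyc⟩ := cycle_CX d v ε hAC hA hC c hlC hlowA hm
      set P : Equiv.Perm (Fin m) := σC⁻¹ * σA with hPdef
      set τ : Equiv.Perm (Fin m) := σB⁻¹ * σA with hτdef
      have hτinv : τ = (σA⁻¹ * σB)⁻¹ := by rw [hτdef, mul_inv_rev, inv_inv]
      have hqτ' : τ q ≠ q := by
        rw [hτinv, Ne, Equiv.Perm.inv_eq_iff_eq]
        exact fun h => hqτ h.symm
      have hsτ' : τ s = s := by
        rw [hτinv, Equiv.Perm.inv_eq_iff_eq]; exact hsτ.symm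
      obtain ⟨Uf, hUF⟩ := exists_arcFamily P τ hfix hcyc
      obtain ⟨j, hj, hcU⟩ := exists_arc_mem P τ hfix hcyc Uf hUF q c hqτ'
      obtain ⟨hjU, hfirst, hcard, hstart, hstep, -, -⟩ := hUF j hj
      set U := Uf j with hUdef
      have hUne : U ≠ univ := by rintro h; rw [h, card_univ, Fintype.card_fin] at hcard; exact lt_irrefl _ hcard
      have hjs : j ≠ s := fun h => hj (by rw [h]; exact hsτ')
      obtain ⟨x₀, hx₀⟩ : ∃ x, x ∉ U := by
        by_contra h; push Not at h; exact hUne (eq_univ_of_forall h)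
      have hinj := oneJump_injective (σA := σB) (σB := σA) (σC := σC) hPdef hτdef hfirst hstart hstep
      refine core_of_oneJump d v ε hm hlC hCge hlowB hlowA hB hA hC hBC hAC (Ne.symm hAB) U j hjU hcU hUne hinj
        (fun h => absurd hlt (lt_asymm h)) ?_
      intro _
      -- goal: `d (λB j) + Σ_{Uᶜ} d c₀ ≤ d (λA j) + Σ_{Uᶜ} d λA` — the raise at `j` against the `A`-surplus off `U`
      have h1 := hsurA U x₀ hx₀
      by_cases hjr : d (lA j) < d (lB j)
      · have hjx₀ : x₀ ≠ j := fun h => hx₀ (by rw [h]; exact hjU)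
        have h2 := hraise {j} x₀ (by rw [mem_singleton]; exact fun h => hjs h.symm) (by rw [mem_singleton]; exact hjx₀)
        rw [sum_singleton] at h2
        linarith
      · have h2 : (d (lB j) : ℤ) ≤ d (lA j) := by exact_mod_cast not_lt.mp hjr
        have h3 : ∑ _x ∈ Uᶜ, (d c₀ : ℤ) ≤ ∑ x ∈ Uᶜ, (d (lA x) : ℤ) :=
          Finset.sum_le_sum fun x _ => by exact_mod_cast (hlowA x).le
        linarith
    · -- UNPRIMED family: `P = σC⁻¹σB`, `τ = σA⁻¹σB`, selector «`σC` off `U`, `σB` on `U ∖ {j}`, `σA` at `j`»; an arc through `c` avoiding `s`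
      obtain ⟨hfix, hcyc⟩ := cycle_CX d v ε hBC hB hC c hlC hlowB hm
      set P : Equiv.Perm (Fin m) := σC⁻¹ * σB with hPdef
      set τ : Equiv.Perm (Fin m) := σA⁻¹ * σB with hτdef
      obtain ⟨Uf, hUF⟩ := exists_arcFamily P τ hfix hcyc
      obtain ⟨j, hj, hcU, hsU⟩ := exists_arc P τ hfix hcyc Uf hUF s c hsτ
      obtain ⟨hjU, hfirst, hcard, hstart, hstep, -, -⟩ := hUF j hj
      set U := Uf j with hUdef
      have hUne : U ≠ univ := by rintro h; rw [h, card_univ, Fintype.card_fin] at hcard; exact lt_irrefl _ hcard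
      obtain ⟨x₀, hx₀⟩ : ∃ x, x ∉ U := by
        by_contra h; push Not at h; exact hUne (eq_univ_of_forall h)
      have hinj := oneJump_injective hPdef hτdef hfirst hstart hstep
      refine core_of_oneJump d v ε hm hlC hCge hlowA hlowB hA hB hC hAC hBC hAB U j hjU hcU hUne hinj ?_
        (fun h => absurd hlt (lt_asymm h))
      intro _
      -- goal: `Σ_{U.erase j} d λB + Σ_{Uᶜ} d c₀ ≤ Σ_{U.erase j} d λA + Σ_{Uᶜ} d λA` — raises on `U ∖ {j}` (no `s` there) against the surplus off `U`
      have h1 := hsurA U x₀ hx₀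
      have hsS : s ∉ U.erase j := by
        rw [mem_erase]
        rintro ⟨h1', h2'⟩
        rcases hsU with h | h
        · exact h h2'
        · exact h1' h
      have hx₀S : x₀ ∉ U.erase j := fun h => hx₀ (mem_erase.mp h).2
      have h2 := hraise (U.erase j) x₀ hsS hx₀S
      rw [Finset.sum_sub_distrib] at h2
      linarith
  · -- CASE `P_B` earlier (`θB < θA`): the raised column `b` of (B1) is moved by `τ = σA⁻¹σB`; UNPRIMED family, an arc through `c` avoiding `b`
    obtain ⟨b, hbr, hbud⟩ := hB1
    have hbτ : (σA⁻¹ * σB) b ≠ b := moved_of_raised d v ε hA hB hgt hbr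
    obtain ⟨hfix, hcyc⟩ := cycle_CX d v ε hBC hB hC c hlC hlowB hm
    set P : Equiv.Perm (Fin m) := σC⁻¹ * σB with hPdef
    set τ : Equiv.Perm (Fin m) := σA⁻¹ * σB with hτdef
    obtain ⟨Uf, hUF⟩ := exists_arcFamily P τ hfix hcyc
    obtain ⟨j, hj, hcU, hbU⟩ := exists_arc P τ hfix hcyc Uf hUF b c hbτ
    obtain ⟨hjU, hfirst, hcard, hstart, hstep, -, -⟩ := hUF j hj
    set U := Uf j with hUdef
    have hUne : U ≠ univ := by rintro h; rw [h, card_univ, Fintype.card_fin] at hcard; exact lt_irrefl _ hcard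
    have hinj := oneJump_injective hPdef hτdef hfirst hstart hstep
    refine core_of_oneJump d v ε hm hlC hCge hlowA hlowB hA hB hC hAC hBC hAB U j hjU hcU hUne hinj
      (fun h => absurd hgt (lt_asymm h)) ?_
    intro _
    -- goal: `d (λA j) + Σ_{Uᶜ} d c₀ ≤ d (λB j) + Σ_{Uᶜ} d λB` — the deficit at `j` against the `B`-surplus off `U`
    rcases hbU with hbU | hbj
    · have h1 := hsurB U b hbU
      have h2 := hbud j
      linarith
    · subst hbj
      have h1 : ∑ _x ∈ Uᶜ, (d c₀ : ℤ) ≤ ∑ x ∈ Uᶜ, (d (lB x) : ℤ) :=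
        Finset.sum_le_sum fun x _ => by exact_mod_cast (hlowB x).le
      have h2 : (d (lA b) : ℤ) < d (lB b) := by exact_mod_cast hbr
      linarith

/-! ## 3. Instances: the two-raised family of the memo, and Core Law C re-derived -/

/-- **THE TWO-RAISED TRANSFER LAW** (memo CORE-LAW-C-g21 §9, all `m`).  Classes `d c₀ < d c₁ < d c₂ < d c₃`; `P_A`: `c₁` at `p`, `c₂`
elsewhere; `P_B`: `c₂` at `p`, `c₃` at `s`, `c₁` on a nonempty column set `Q ∌ p, s`, `c₂` elsewhere; `P_C`: `c₀` off one column `c`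
(anything of exponent `≥ d c₀` at `c`), the latest.  Then `P_A`, `P_B`, `P_C` are not all dominant. [this cell] -/
theorem two_raised_transfer (d : Fin K → ℕ) (v ε : Fin m → Fin m → Fin K → ℤ)
    {c₀ c₁ c₂ c₃ : Fin K} (h01 : d c₀ < d c₁) (h12 : d c₁ < d c₂) (h23 : d c₂ < d c₃)
    {σA σB σC : Equiv.Perm (Fin m)} {lA lB lC : Fin m → Fin K} {p s c : Fin m} {Q : Finset (Fin m)}
    (hQ : Q.Nonempty) (hpQ : p ∉ Q) (hsQ : s ∉ Q) (hps : p ≠ s)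
    (hlA : ∀ x, lA x = if x = p then c₁ else c₂)
    (hlB : ∀ x, lB x = if x = p then c₂ else if x = s then c₃ else if x ∈ Q then c₁ else c₂)
    (hlC : ∀ x, x ≠ c → lC x = c₀) (hCge : ∀ x, d c₀ ≤ d (lC x))
    {θA θB θC : ℤ} (hA : IsDominant d v ε θA (σA, lA)) (hB : IsDominant d v ε θB (σB, lB)) (hC : IsDominant d v ε θC (σC, lC))
    (hAC : θA < θC) (hBC : θB < θC) : False := by
  classical
  -- exponent tables
  have hAp : d (lA p) = d c₁ := by rw [hlA p, if_pos rfl]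
  have hAne : ∀ x, x ≠ p → d (lA x) = d c₂ := fun x hx => by rw [hlA x, if_neg hx]
  have hBp : d (lB p) = d c₂ := by rw [hlB p, if_pos rfl]
  have hBs : d (lB s) = d c₃ := by rw [hlB s, if_neg (Ne.symm hps), if_pos rfl]
  have hBQ : ∀ x, x ∈ Q → d (lB x) = d c₁ := fun x hx => by
    have hxp : x ≠ p := fun h => hpQ (h ▸ hx)
    have hxs : x ≠ s := fun h => hsQ (h ▸ hx)
    rw [hlB x, if_neg hxp, if_neg hxs, if_pos hx]
  have hBother : ∀ x, x ≠ p → x ≠ s → x ∉ Q → d (lB x) = d c₂ := fun x hxp hxs hxQ => by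
    rw [hlB x, if_neg hxp, if_neg hxs, if_neg hxQ]
  have hAle : ∀ x, d (lA x) ≤ d c₂ := fun x => by
    by_cases hx : x = p
    · rw [hx, hAp]; exact h12.le
    · rw [hAne x hx]
  have hAge : ∀ x, d c₁ ≤ d (lA x) := fun x => by
    by_cases hx : x = p
    · rw [hx, hAp]
    · rw [hAne x hx]; exact h12.le
  have hBge : ∀ x, d c₁ ≤ d (lB x) := fun x => by
    by_cases hxp : x = p
    · rw [hxp, hBp]; exact h12.le
    · by_cases hxs : x = s
      · rw [hxs, hBs]; exact (h12.trans h23).le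
      · by_cases hxQ : x ∈ Q
        · rw [hBQ x hxQ]
        · rw [hBother x hxp hxs hxQ]; exact h12.le
  -- a raised column other than `s` is `p`
  have hraised : ∀ x, d (lA x) < d (lB x) → x ≠ s → x = p := by
    intro x hx hxs
    by_contra hxp
    rw [hAne x hxp] at hx
    by_cases hxQ : x ∈ Q
    · rw [hBQ x hxQ] at hx; exact lt_asymm h12 hx
    · rw [hBother x hxp hxs hxQ] at hx; exact lt_irrefl _ hx
  obtain ⟨q, hqQ⟩ := hQ
  have hqp : q ≠ p := fun h => hpQ (h ▸ hqQ)
  refine multiRaise_transfer d v ε (s := s) hlC hCge (fun x => lt_of_lt_of_le h01 (hAge x)) (fun x => lt_of_lt_of_le h01 (hBge x))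
    hA hB hC hAC hBC ⟨q, by rw [hBQ q hqQ, hAne q hqp]; exact h12⟩ (by rw [hBs, hAne s (Ne.symm hps)]; exact h23) ?_
    ⟨s, by rw [hBs, hAne s (Ne.symm hps)]; exact h23, fun j => ?_⟩
  · -- (A1): the only small raise is `d c₂ − d c₁` at `p`
    intro y
    by_cases hy : y = p
    · -- no raised column other than `s` and `p = y`
      have hempty : univ.filter (fun x => x ≠ s ∧ x ≠ y ∧ d (lA x) < d (lB x)) = ∅ := by
        refine filter_eq_empty_iff.mpr fun x _ h => ?_
        exact h.2.1 (hy ▸ hraised x h.2.2 h.1)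
      rw [hempty, sum_empty, hy, hAp]
      have : (d c₀ : ℤ) < d c₁ := by exact_mod_cast h01
      linarith
    · have hsub : univ.filter (fun x => x ≠ s ∧ x ≠ y ∧ d (lA x) < d (lB x)) ⊆ {p} := by
        intro x hx
        have h := (mem_filter.mp hx).2
        rw [mem_singleton]; exact hraised x h.2.2 h.1
      calc ∑ x ∈ univ.filter (fun x => x ≠ s ∧ x ≠ y ∧ d (lA x) < d (lB x)), ((d (lB x) : ℤ) - d (lA x))
          ≤ ∑ x ∈ ({p} : Finset (Fin m)), ((d (lB x) : ℤ) - d (lA x)) := by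
            apply Finset.sum_le_sum_of_subset_of_nonneg hsub
            intro x hx _
            rw [mem_singleton] at hx
            rw [hx, hBp, hAp]
            have : (d c₁ : ℤ) < d c₂ := by exact_mod_cast h12
            linarith
        _ = (d c₂ : ℤ) - d c₁ := by rw [sum_singleton, hBp, hAp]
        _ ≤ (d (lA y) : ℤ) - d c₀ := by
            rw [hAne y hy]
            have : (d c₀ : ℤ) < d c₁ := by exact_mod_cast h01
            linarith
  · -- (B1) with `b = s`: every deficit is `≤ d c₂ − d c₁ < d c₃ − d c₀`
    rw [hBs]
    have h1 : (d (lA j) : ℤ) ≤ d c₂ := by exact_mod_cast hAle j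
    have h2 : (d c₁ : ℤ) ≤ d (lB j) := by exact_mod_cast hBge j
    have h3 : (d c₀ : ℤ) < d c₁ := by exact_mod_cast h01
    have h4 : (d c₂ : ℤ) < d c₃ := by exact_mod_cast h23
    linarith

/-- **Core Law C is an instance** of `multiRaise_transfer` (no small raise; `b = s =` the `c₃`-column of `P_B`): re-derivation of
`core_law_C` (…TopHeavyCoreArc) as a consistency check of the general statement. [this cell] -/
theorem core_law_C_of_multiRaise (d : Fin K → ℕ) (v ε : Fin m → Fin m → Fin K → ℤ)
    {c₀ c₁ c₂ c₃ c₄ : Fin K} (h01 : d c₀ < d c₁) (h12 : d c₁ < d c₂) (h23 : d c₂ < d c₃) (hmin : ∀ l, d c₀ ≤ d l)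
    {σA σB σC : Equiv.Perm (Fin m)} {lA lB lC : Fin m → Fin K} {a₁ a₂ b c : Fin m} (hne : a₁ ≠ a₂)
    (hlA : ∀ x, lA x = if x = a₁ ∨ x = a₂ then c₂ else c₁) (hlB : ∀ x, lB x = if x = b then c₃ else c₁)
    (hlC : ∀ x, lC x = if x = c then c₄ else c₀)
    {θA θB θC : ℤ} (hA : IsDominant d v ε θA (σA, lA)) (hB : IsDominant d v ε θB (σB, lB)) (hC : IsDominant d v ε θC (σC, lC))
    (hAC : θA < θC) (hBC : θB < θC) : False := by
  classical
  have hAle : ∀ x, d (lA x) ≤ d c₂ := fun x => by rw [hlA x]; split_ifs <;> omega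
  have hAge : ∀ x, d c₁ ≤ d (lA x) := fun x => by rw [hlA x]; split_ifs <;> omega
  have hBb : d (lB b) = d c₃ := by rw [hlB b, if_pos rfl]
  have hBne : ∀ x, x ≠ b → d (lB x) = d c₁ := fun x hx => by rw [hlB x, if_neg hx]
  have hBge : ∀ x, d c₁ ≤ d (lB x) := fun x => by
    by_cases hx : x = b
    · rw [hx, hBb]; exact (h12.trans h23).le
    · rw [hBne x hx]
  -- the only raised column is `b`
  have hraised : ∀ x, d (lA x) < d (lB x) → x = b := by
    intro x hx
    by_contra hxb
    rw [hBne x hxb] at hx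
    exact absurd (hAge x) (not_le.mpr hx)
  -- a lowered column: an `a_i ≠ b`
  obtain ⟨q, hqa, hqb⟩ : ∃ q, (q = a₁ ∨ q = a₂) ∧ q ≠ b := by
    by_cases h : a₁ = b
    · exact ⟨a₂, Or.inr rfl, fun h' => hne (h.trans h'.symm)⟩
    · exact ⟨a₁, Or.inl rfl, h⟩
  have hAq : d (lA q) = d c₂ := by rw [hlA q, if_pos hqa]
  refine multiRaise_transfer d v ε (s := b) (fun x hx => by rw [hlC x, if_neg hx]) (fun x => hmin _)
    (fun x => lt_of_lt_of_le h01 (hAge x)) (fun x => lt_of_lt_of_le h01 (hBge x)) hA hB hC hAC hBC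
    ⟨q, by rw [hBne q hqb, hAq]; exact h12⟩ (by rw [hBb]; exact lt_of_le_of_lt (hAle b) h23) ?_
    ⟨b, by rw [hBb]; exact lt_of_le_of_lt (hAle b) h23, fun j => ?_⟩
  · intro y
    have hempty : univ.filter (fun x => x ≠ b ∧ x ≠ y ∧ d (lA x) < d (lB x)) = ∅ :=
      filter_eq_empty_iff.mpr fun x _ h => h.1 (hraised x h.2.2)
    rw [hempty, sum_empty]
    have h1 : (d c₀ : ℤ) < d c₁ := by exact_mod_cast h01
    have h2 : (d c₁ : ℤ) ≤ d (lA y) := by exact_mod_cast hAge y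
    linarith
  · rw [hBb]
    have h1 : (d (lA j) : ℤ) ≤ d c₂ := by exact_mod_cast hAle j
    have h2 : (d c₁ : ℤ) ≤ d (lB j) := by exact_mod_cast hBge j
    have h3 : (d c₀ : ℤ) < d c₁ := by exact_mod_cast h01
    have h4 : (d c₂ : ℤ) < d c₃ := by exact_mod_cast h23
    linarith

end Summit.ValiantsHypothesis.ValiantsHypothesis.Theorems.KPlusLogSqLaw.TopHeavyCore
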